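import Literature.Computability.MetaComplexity.EFModMulUMaskMul
import HarnessLib

/-!
# Associativity of uniform modular multiplication, part A: the kit

Layer E/8 (uniform variant). The associativity KIT `ModMulU.Assoc.assocT L` on the inputs
`a, b, c, n, z` (`4L + 1`): the comparators `(a, n)`, `(b, n)`, the certified multipliers
`AB = a ⊗ b`, `BC_s = b ⊗ C_s`, `LHS_s = P_L(AB) ⊗ C_s`, `ABC_s = a ⊗ P_L(BC_s)`
(`C_s = c >> (L - s)`, `s ≤ L`), and per stage `s < L` the right-distributivity kits `RD1_s` on
`(a; R(D_{L-1}(BC_{s+1})), mk_{L-1}(BC_{s+1}))` and `RD2_s` on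
`(a; P_{L-1}(BC_{s+1}), P_{L-1}(BC_{s+1}))`. Part B proves `(a ⊗ b) ⊗ C_s ≡ a ⊗ (b ⊗ C_s)`
by induction on `s` and concludes `(a ⊗ b) ⊗ c ≡ a ⊗ (b ⊗ c)`.

## Sources

* H. Vollmer, *Introduction to Circuit Complexity* (Springer 1999), §1.2–1.3.
* J. Krajíček, *Bounded Arithmetic, Propositional Logic, and Complexity Theory* (CUP 1995), §9.2.
-/

namespace Literature.Computability.MetaComplexity

open _root_.Computability Complexity Complexity.PropForm Netlist Cluster FregeSystem

namespace ModMulU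

namespace Assoc

variable (L : ℕ)

/-! ### The pieces -/

/-- Length of a right-distributivity kit. [folklore] -/
def RDL (L : ℕ) : ℕ := Comm.LDL L + 3 * RD.CL L + (6 * L + 2)
/-- Offset of `AB`. [folklore] -/
def oAB (L : ℕ) : ℕ := 6 * L + 2
/-- Offset of `BC_s`. [folklore] -/
def oBC (L s : ℕ) : ℕ := oAB L + (1 + s) * LD.RT L
/-- Offset of `LHS_s`. [folklore] -/
def oLHS (L s : ℕ) : ℕ := oAB L + (2 + L + s) * LD.RT L
/-- Offset of `ABC_s`. [folklore] -/
def oABC (L s : ℕ) : ℕ := oAB L + (3 + 2 * L + s) * LD.RT L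
/-- Offset of `RD1_0`. [folklore] -/
def oR (L : ℕ) : ℕ := oAB L + (4 + 3 * L) * LD.RT L

/-- Reference to bit `j` of `C = c >> k` (kit inputs `a, b, c, n, z`). [folklore] -/
def Cref (k j : ℕ) : ℕ ⊕ ℕ := if j + k < L then Sum.inl (2 * L + (j + k)) else Sum.inl (4 * L)

/-- Wiring of `BC_s = b ⊗ C_s`. [folklore] -/
def wBC (s : ℕ) (i : ℕ) : ℕ ⊕ ℕ := if i < L then Sum.inl (L + i) else if i < 2 * L then Cref L (L - s) (i - L) else Sum.inl (L + i)
/-- Wiring of `LHS_s = P_L(AB) ⊗ C_s`. [folklore] -/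
def wLHS (s : ℕ) (i : ℕ) : ℕ ⊕ ℕ :=
  if i < L then Sum.inr (LD.pP L (oAB L) L i) else if i < 2 * L then Cref L (L - s) (i - L) else Sum.inl (L + i)
/-- Wiring of `ABC_s = a ⊗ P_L(BC_s)`. [folklore] -/
def wABC (s : ℕ) (i : ℕ) : ℕ ⊕ ℕ :=
  if i < L then Sum.inl i else if i < 2 * L then Sum.inr (LD.pP L (oBC L s) L (i - L)) else Sum.inl (L + i)
/-- Wiring of `RD1_s` on `(a; R(D_{L-1}(BC_{s+1})), mk_{L-1}(BC_{s+1}), n, z)`. [folklore] -/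
def wR1 (s : ℕ) (i : ℕ) : ℕ ⊕ ℕ :=
  if i < L then Sum.inl i else if i < 2 * L then Sum.inr (oBC L (s + 1) + offD L (L - 1) + (5 * L + 2) + (i - L))
  else if i < 3 * L then Sum.inr (oBC L (s + 1) + offM L (L - 1) + (i - 2 * L)) else if i < 4 * L then Sum.inl i else Sum.inl (4 * L)
/-- Wiring of `RD2_s` on `(a; P_{L-1}(BC_{s+1}), P_{L-1}(BC_{s+1}), n, z)`. [folklore] -/
def wR2 (s : ℕ) (i : ℕ) : ℕ ⊕ ℕ :=
  if i < L then Sum.inl i else if i < 2 * L then Sum.inr (LD.pP L (oBC L (s + 1)) (L - 1) (i - L))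
  else if i < 3 * L then Sum.inr (LD.pP L (oBC L (s + 1)) (L - 1) (i - 2 * L)) else if i < 4 * L then Sum.inl i else Sum.inl (4 * L)

/-- The pieces. [cite: Vollmer1999, §1.2] -/
def pieces (L : ℕ) (k : ℕ) : Piece :=
  if k = 0 then ⟨Sub.subT L, 2 * L, fun i => if i < L then Sum.inl i else Sum.inl (2 * L + i)⟩
  else if k = 1 then ⟨Sub.subT L, 2 * L, fun i => if i < L then Sum.inl (L + i) else Sum.inl (2 * L + i)⟩
  else if k = 2 then ⟨mulRT L, 3 * L, fun i => if i < 2 * L then Sum.inl i else Sum.inl (L + i)⟩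
  else if k ≤ 3 + L then ⟨mulRT L, 3 * L, wBC L (k - 3)⟩
  else if k ≤ 4 + 2 * L then ⟨mulRT L, 3 * L, wLHS L (k - 4 - L)⟩
  else if k ≤ 5 + 3 * L then ⟨mulRT L, 3 * L, wABC L (k - 5 - 2 * L)⟩
  else if (k - 6 - 3 * L) % 2 = 0 then ⟨RD.rdT L, 4 * L + 1, wR1 L ((k - 6 - 3 * L) / 2)⟩
  else ⟨RD.rdT L, 4 * L + 1, wR2 L ((k - 6 - 3 * L) / 2)⟩

/-- Closed-form offsets. [folklore] -/
def offF (L : ℕ) (k : ℕ) : ℕ :=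
  if k = 0 then 0 else if k = 1 then 3 * L + 1 else if k ≤ 6 + 3 * L then oAB L + (k - 2) * LD.RT L else oR L + (k - 6 - 3 * L) * RDL L

/-- **The associativity kit.** [cite: Vollmer1999, §1.2–1.3] -/
def assocT (L : ℕ) : Template := layout (pieces L) (6 + 5 * L)

/-- Length of a right-distributivity kit. [folklore] -/
theorem length_rdT (hL : 0 < L) : (RD.rdT L).length = RDL L := by
  rw [RD.rdT, length_layout, (RD.offset_pieces L hL).2.2.2.2]; rfl

/-- The length of piece `k`. [folklore] -/
theorem length_piece (hL : 0 < L) (k : ℕ) :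
    (pieces L k).T.length = if k ≤ 1 then 3 * L + 1 else if k ≤ 5 + 3 * L then LD.RT L else RDL L := by
  unfold pieces
  by_cases h0 : k = 0
  · subst h0; simp
  by_cases h1 : k = 1
  · subst h1; simp
  rw [if_neg h0, if_neg h1, if_neg (show ¬k ≤ 1 by omega)]
  by_cases h2 : k = 2
  · subst h2; simp [LD.RT, ML, show (2 : ℕ) ≤ 5 + 3 * L from by omega]
  rw [if_neg h2]
  by_cases h3 : k ≤ 3 + L
  · rw [if_pos h3, if_pos (show k ≤ 5 + 3 * L by omega)]; simp [LD.RT, ML]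
  rw [if_neg h3]
  by_cases h4 : k ≤ 4 + 2 * L
  · rw [if_pos h4, if_pos (show k ≤ 5 + 3 * L by omega)]; simp [LD.RT, ML]
  rw [if_neg h4]
  by_cases h5 : k ≤ 5 + 3 * L
  · rw [if_pos h5, if_pos h5]; simp [LD.RT, ML]
  rw [if_neg h5, if_neg h5]
  by_cases h6 : (k - 6 - 3 * L) % 2 = 0
  · rw [if_pos h6]; exact length_rdT L hL
  · rw [if_neg h6]; exact length_rdT L hL

/-- The closed form steps like the lengths. [folklore] -/
theorem offF_succ (hL : 0 < L) (k : ℕ) : offF L (k + 1) = offF L k + (pieces L k).T.length := by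
  rw [length_piece L hL]
  unfold offF
  by_cases h0 : k = 0
  · subst h0; simp
  by_cases h1 : k = 1
  · subst h1; simp [oAB, show (2 : ℕ) ≤ 6 + 3 * L from by omega]; ring
  have g : ¬(k ≤ 1) := by omega
  simp only [h0, h1, g, show ¬(k + 1 = 0) by omega, show ¬(k + 1 = 1) by omega, if_false]
  by_cases h2 : k ≤ 5 + 3 * L
  · simp only [h2, show k + 1 ≤ 6 + 3 * L by omega, show k ≤ 6 + 3 * L by omega, if_true]
    rw [show k + 1 - 2 = k - 2 + 1 by omega]; ring
  · simp only [h2, show ¬(k + 1 ≤ 6 + 3 * L) by omega, if_false]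
    by_cases h3 : k ≤ 6 + 3 * L
    · have hk : k = 6 + 3 * L := by omega
      subst hk
      simp only [le_refl, if_true, show 6 + 3 * L + 1 - 6 - 3 * L = 1 by omega, Nat.one_mul]
      unfold oR; rw [show 6 + 3 * L - 2 = 4 + 3 * L by omega]
    · simp only [h3, if_false]
      rw [show k + 1 - 6 - 3 * L = k - 6 - 3 * L + 1 by omega]; ring

/-- **The offsets of the pieces are the closed forms.** [folklore] -/
theorem offset_pieces (hL : 0 < L) : ∀ k, offset (pieces L) k = offF L k := by
  intro k
  induction k with
  | zero => rfl
  | succ k ih => rw [offset_succ, ih, offF_succ L hL k]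

/-- Offsets of the multipliers. [folklore] -/
theorem offF_mul {k : ℕ} (hk : 2 ≤ k) (hk' : k ≤ 6 + 3 * L) : offF L k = oAB L + (k - 2) * LD.RT L := by
  unfold offF; rw [if_neg (by omega), if_neg (by omega), if_pos hk']

/-- Offsets of the right-distributivity kits. [folklore] -/
theorem offF_rd (s j : ℕ) : offF L (6 + 3 * L + (2 * s + j)) = oR L + (2 * s + j) * RDL L := by
  unfold offF
  rcases Nat.eq_zero_or_pos (2 * s + j) with h | h
  · rw [h, if_neg (by omega), if_neg (by omega), if_pos (by omega), Nat.add_zero, show 6 + 3 * L - 2 = 4 + 3 * L by omega,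
      Nat.zero_mul, Nat.add_zero]; rfl
  · rw [if_neg (by omega), if_neg (by omega), if_neg (by omega), show 6 + 3 * L + (2 * s + j) - 6 - 3 * L = 2 * s + j by omega]

/-- A reference to a bit of `C`. [folklore] -/
theorem Cref_ok (k j : ℕ) {off : ℕ} : (∀ a, Cref L k j = Sum.inl a → a < 4 * L + 1) ∧ (∀ g, Cref L k j = Sum.inr g → g < off) := by
  unfold Cref; split_ifs <;> exact ⟨fun a ha => (by cases ha; omega), fun g hg => by cases hg⟩

/-- A `P`-gate of a multiplier at offset `oV` lies below `oV + RT`. [folklore] -/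
theorem pP_lt' {oV t i : ℕ} (ht : t ≤ L) (hi : i < L) : LD.pP L oV t i < oV + LD.RT L := LD.pP_lt L ht hi

/-- A gate of stage `L - 1` of a multiplier at offset `oV` lies below `oV + RT`. [folklore] -/
theorem stageGate_lt (hL : 0 < L) {oV i : ℕ} (hi : i < L) :
    oV + offD L (L - 1) + (5 * L + 2) + i < oV + LD.RT L ∧ oV + offM L (L - 1) + i < oV + LD.RT L := by
  have h1 := LD.pD_lt L (oV := oV) (t := L - 1) (i := i) (by omega) hi
  have h2 := LD.pM_lt L (oV := oV) (t := L - 1) (i := i) (by omega) hi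
  unfold LD.pD at h1; unfold LD.pM at h2
  exact ⟨h1, h2⟩

/-- Every piece is well formed and well wired (`4L + 1` inputs). [cite: Vollmer1999, Def. 1.6] -/
theorem piece_ok (hL : 0 < L) : ∀ k < 6 + 5 * L, Piece.OK (pieces L) (4 * L + 1) k := by
  intro k hk
  unfold Piece.OK
  rw [offset_pieces L hL k]
  unfold pieces
  by_cases h0 : k = 0
  · subst h0; simp only [if_true]
    exact ⟨Sub.wf_subT L, fun i hi => by split_ifs <;> exact ⟨fun a ha => (by cases ha; omega), fun g hg => by cases hg⟩⟩
  by_cases h1 : k = 1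
  · subst h1; simp only [show (1 : ℕ) ≠ 0 from by decide, if_false, if_true]
    exact ⟨Sub.wf_subT L, fun i hi => by split_ifs <;> exact ⟨fun a ha => (by cases ha; omega), fun g hg => by cases hg⟩⟩
  by_cases h2 : k = 2
  · subst h2; simp only [show (2 : ℕ) ≠ 0 from by decide, show (2 : ℕ) ≠ 1 from by decide, if_false, if_true]
    exact ⟨wf_mulRT L, fun i hi => by split_ifs <;> exact ⟨fun a ha => (by cases ha; omega), fun g hg => by cases hg⟩⟩
  rw [if_neg h0, if_neg h1, if_neg h2]
  by_cases h3 : k ≤ 3 + L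
  · rw [if_pos h3]
    refine ⟨wf_mulRT L, fun i hi => ?_⟩
    dsimp only at hi ⊢; unfold wBC
    split_ifs
    · exact ⟨fun a ha => (by cases ha; omega), fun g hg => by cases hg⟩
    · exact Cref_ok L _ _
    · exact ⟨fun a ha => (by cases ha; omega), fun g hg => by cases hg⟩
  rw [if_neg h3]
  by_cases h4 : k ≤ 4 + 2 * L
  · rw [if_pos h4, offF_mul L (by omega) (by omega)]
    refine ⟨wf_mulRT L, fun i hi => ?_⟩
    dsimp only at hi ⊢; unfold wLHS
    split_ifs with g1 g2
    · refine ⟨fun a ha => (by cases ha), fun g hg => ?_⟩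
      cases hg
      have := pP_lt' L (oV := oAB L) (t := L) le_rfl g1
      have : LD.RT L ≤ (k - 2) * LD.RT L := Nat.le_mul_of_pos_left _ (by omega)
      omega
    · exact Cref_ok L _ _
    · exact ⟨fun a ha => (by cases ha; omega), fun g hg => by cases hg⟩
  rw [if_neg h4]
  by_cases h5 : k ≤ 5 + 3 * L
  · rw [if_pos h5, offF_mul L (by omega) (by omega)]
    refine ⟨wf_mulRT L, fun i hi => ?_⟩
    dsimp only at hi ⊢; unfold wABC
    split_ifs with g1 g2
    · exact ⟨fun a ha => (by cases ha; omega), fun g hg => by cases hg⟩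
    · refine ⟨fun a ha => (by cases ha), fun g hg => ?_⟩
      cases hg
      have := pP_lt' L (oV := oBC L (k - 5 - 2 * L)) (t := L) (i := i - L) le_rfl (by omega)
      have e : oBC L (k - 5 - 2 * L) + LD.RT L ≤ oAB L + (k - 2) * LD.RT L := by
        unfold oBC; rw [Nat.add_assoc, ← Nat.succ_mul]; exact Nat.add_le_add_left (Nat.mul_le_mul_right _ (by omega)) _
      omega
    · exact ⟨fun a ha => (by cases ha; omega), fun g hg => by cases hg⟩
  rw [if_neg h5]
  obtain ⟨s, j, hj, hk'⟩ : ∃ s j, j < 2 ∧ k = 6 + 3 * L + (2 * s + j) := ⟨(k - 6 - 3 * L) / 2, (k - 6 - 3 * L) % 2, Nat.mod_lt _ (by omega), by omega⟩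
  subst hk'
  rw [offF_rd L s j]
  have hs : s < L := by omega
  have hbc : oBC L (s + 1) + LD.RT L ≤ oR L := by
    unfold oBC oR; rw [Nat.add_assoc, ← Nat.succ_mul]; exact Nat.add_le_add_left (Nat.mul_le_mul_right _ (by omega)) _
  have e2 : (6 + 3 * L + (2 * s + j) - 6 - 3 * L) = 2 * s + j := by omega
  rw [e2]
  rcases (show j = 0 ∨ j = 1 by omega) with rfl | rfl
  · rw [if_pos (by omega), show (2 * s + 0) / 2 = s by omega]
    refine ⟨RD.wf_rdT L hL, fun i hi => ?_⟩
    dsimp only at hi ⊢; unfold wR1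
    split_ifs with g1 g2 g3 g4
    · exact ⟨fun a ha => (by cases ha; omega), fun g hg => by cases hg⟩
    · refine ⟨fun a ha => (by cases ha), fun g hg => ?_⟩
      cases hg; have := (stageGate_lt L hL (oV := oBC L (s + 1)) (i := i - L) (by omega)).1; nlinarith [Nat.zero_le (RDL L)]
    · refine ⟨fun a ha => (by cases ha), fun g hg => ?_⟩
      cases hg; have := (stageGate_lt L hL (oV := oBC L (s + 1)) (i := i - 2 * L) (by omega)).2; nlinarith [Nat.zero_le (RDL L)]
    · exact ⟨fun a ha => (by cases ha; omega), fun g hg => by cases hg⟩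
    · exact ⟨fun a ha => (by cases ha; omega), fun g hg => by cases hg⟩
  · rw [if_neg (by omega), show (2 * s + 1) / 2 = s by omega]
    refine ⟨RD.wf_rdT L hL, fun i hi => ?_⟩
    dsimp only at hi ⊢; unfold wR2
    split_ifs with g1 g2 g3 g4
    · exact ⟨fun a ha => (by cases ha; omega), fun g hg => by cases hg⟩
    · refine ⟨fun a ha => (by cases ha), fun g hg => ?_⟩
      cases hg; have := pP_lt' L (oV := oBC L (s + 1)) (t := L - 1) (i := i - L) (by omega) (by omega); nlinarith [Nat.zero_le (RDL L)]
    · refine ⟨fun a ha => (by cases ha), fun g hg => ?_⟩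
      cases hg; have := pP_lt' L (oV := oBC L (s + 1)) (t := L - 1) (i := i - 2 * L) (by omega) (by omega); nlinarith [Nat.zero_le (RDL L)]
    · exact ⟨fun a ha => (by cases ha; omega), fun g hg => by cases hg⟩
    · exact ⟨fun a ha => (by cases ha; omega), fun g hg => by cases hg⟩

/-- **The associativity kit is well formed** (`4L + 1` inputs). [cite: Vollmer1999, Def. 1.6] -/
theorem wf_assocT (hL : 0 < L) : (assocT L).WF (4 * L + 1) := wf_layout (pieces L) fun k hk => piece_ok L hL k hk

/-! ### Unfolding the pieces -/

/-- Pieces `0, 1, 2`. [folklore] -/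
theorem pieces_012 :
    pieces L 0 = ⟨Sub.subT L, 2 * L, fun i => if i < L then Sum.inl i else Sum.inl (2 * L + i)⟩ ∧
    pieces L 1 = ⟨Sub.subT L, 2 * L, fun i => if i < L then Sum.inl (L + i) else Sum.inl (2 * L + i)⟩ ∧
    pieces L 2 = ⟨mulRT L, 3 * L, fun i => if i < 2 * L then Sum.inl i else Sum.inl (L + i)⟩ := ⟨rfl, rfl, rfl⟩

/-- Piece `3 + s` is `BC_s`. [folklore] -/
theorem pieces_BC {s : ℕ} (hs : s ≤ L) : pieces L (3 + s) = ⟨mulRT L, 3 * L, wBC L s⟩ := by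
  unfold pieces
  rw [if_neg (show ¬3 + s = 0 by omega), if_neg (show ¬3 + s = 1 by omega), if_neg (show ¬3 + s = 2 by omega),
    if_pos (show 3 + s ≤ 3 + L by omega), show 3 + s - 3 = s by omega]

/-- Piece `4 + L + s` is `LHS_s`. [folklore] -/
theorem pieces_LHS {s : ℕ} (hs : s ≤ L) : pieces L (4 + L + s) = ⟨mulRT L, 3 * L, wLHS L s⟩ := by
  unfold pieces
  rw [if_neg (show ¬4 + L + s = 0 by omega), if_neg (show ¬4 + L + s = 1 by omega), if_neg (show ¬4 + L + s = 2 by omega),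
    if_neg (show ¬4 + L + s ≤ 3 + L by omega), if_pos (show 4 + L + s ≤ 4 + 2 * L by omega), show 4 + L + s - 4 - L = s by omega]

/-- Piece `5 + 2L + s` is `ABC_s`. [folklore] -/
theorem pieces_ABC {s : ℕ} (hs : s ≤ L) : pieces L (5 + 2 * L + s) = ⟨mulRT L, 3 * L, wABC L s⟩ := by
  unfold pieces
  rw [if_neg (show ¬5 + 2 * L + s = 0 by omega), if_neg (show ¬5 + 2 * L + s = 1 by omega), if_neg (show ¬5 + 2 * L + s = 2 by omega),
    if_neg (show ¬5 + 2 * L + s ≤ 3 + L by omega), if_neg (show ¬5 + 2 * L + s ≤ 4 + 2 * L by omega),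
    if_pos (show 5 + 2 * L + s ≤ 5 + 3 * L by omega), show 5 + 2 * L + s - 5 - 2 * L = s by omega]

/-- Piece `6 + 3L + 2s` is `RD1_s`. [folklore] -/
theorem pieces_R1 (s : ℕ) : pieces L (6 + 3 * L + 2 * s) = ⟨RD.rdT L, 4 * L + 1, wR1 L s⟩ := by
  unfold pieces
  rw [if_neg (show ¬6 + 3 * L + 2 * s = 0 by omega), if_neg (show ¬6 + 3 * L + 2 * s = 1 by omega), if_neg (show ¬6 + 3 * L + 2 * s = 2 by omega),
    if_neg (show ¬6 + 3 * L + 2 * s ≤ 3 + L by omega), if_neg (show ¬6 + 3 * L + 2 * s ≤ 4 + 2 * L by omega),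
    if_neg (show ¬6 + 3 * L + 2 * s ≤ 5 + 3 * L by omega), if_pos (show (6 + 3 * L + 2 * s - 6 - 3 * L) % 2 = 0 by omega),
    show (6 + 3 * L + 2 * s - 6 - 3 * L) / 2 = s by omega]

/-- Piece `7 + 3L + 2s` is `RD2_s`. [folklore] -/
theorem pieces_R2 (s : ℕ) : pieces L (7 + 3 * L + 2 * s) = ⟨RD.rdT L, 4 * L + 1, wR2 L s⟩ := by
  unfold pieces
  rw [if_neg (show ¬7 + 3 * L + 2 * s = 0 by omega), if_neg (show ¬7 + 3 * L + 2 * s = 1 by omega), if_neg (show ¬7 + 3 * L + 2 * s = 2 by omega),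
    if_neg (show ¬7 + 3 * L + 2 * s ≤ 3 + L by omega), if_neg (show ¬7 + 3 * L + 2 * s ≤ 4 + 2 * L by omega),
    if_neg (show ¬7 + 3 * L + 2 * s ≤ 5 + 3 * L by omega), if_neg (show ¬(7 + 3 * L + 2 * s - 6 - 3 * L) % 2 = 0 by omega),
    show (7 + 3 * L + 2 * s - 6 - 3 * L) / 2 = s by omega]

/-! ### The views of an occurrence -/

section Views

variable (o : Occ)

/-- Operand `a`. [folklore] -/
def av (i : ℕ) : ℕ := o.inp i
/-- Operand `b`. [folklore] -/
def bv (i : ℕ) : ℕ := o.inp (L + i)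
/-- The shifted words `Cw k = c >> k` (zero gate above); `C_s = Cw (L - s)`. [folklore] -/
def Cw (k j : ℕ) : ℕ := if j + k < L then o.inp (2 * L + (j + k)) else o.inp (4 * L)
/-- The modulus. [folklore] -/
def nv (i : ℕ) : ℕ := o.inp (3 * L + i)
/-- The zero gate. [folklore] -/
def zv : ℕ := o.inp (4 * L)
/-- The comparator `(a, n)`. [folklore] -/
def CmpA : Sub.View := ⟨o.base, av o, nv L o⟩
/-- The comparator `(b, n)`. [folklore] -/
def CmpB : Sub.View := ⟨o.base + (3 * L + 1), bv L o, nv L o⟩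
/-- `AB = a ⊗ b`. [folklore] -/
def AB : View := ⟨o.base + oAB L, av o, bv L o, nv L o⟩
/-- `BC_s = b ⊗ C_s`. [folklore] -/
def BC (s : ℕ) : View := ⟨o.base + oBC L s, bv L o, Cw L o (L - s), nv L o⟩
/-- `LHS_s = P_L(AB) ⊗ C_s`. [folklore] -/
def LHS (s : ℕ) : View := ⟨o.base + oLHS L s, (AB L o).P L L, Cw L o (L - s), nv L o⟩
/-- `ABC_s = a ⊗ P_L(BC_s)`. [folklore] -/
def ABC (s : ℕ) : View := ⟨o.base + oABC L s, av o, (BC L o s).P L L, nv L o⟩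
/-- The occurrence of `RD1_s`. [folklore] -/
def R1 (s : ℕ) : Occ := pieceOcc (o.inst (4 * L + 1)) (pieces L) (6 + 3 * L + 2 * s)
/-- The occurrence of `RD2_s`. [folklore] -/
def R2 (s : ℕ) : Occ := pieceOcc (o.inst (4 * L + 1)) (pieces L) (7 + 3 * L + 2 * s)

/-- All pieces of the associativity kit are available. [folklore] -/
structure AAvail (K : PropForm ℕ) (Γ : Set (PropForm ℕ)) : Prop where
  /-- `(a, n)` -/
  hA : (CmpA L o).Avail K Γ L
  /-- `(b, n)` -/
  hB : (CmpB L o).Avail K Γ L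
  /-- `AB` -/
  hAB : (AB L o).RAvail L K Γ
  /-- `BC_s` -/
  hBC : ∀ s ≤ L, (BC L o s).RAvail L K Γ
  /-- `LHS_s` -/
  hLHS : ∀ s ≤ L, (LHS L o s).RAvail L K Γ
  /-- `ABC_s` -/
  hABC : ∀ s ≤ L, (ABC L o s).RAvail L K Γ
  /-- `RD1_s` -/
  hR1 : ∀ s < L, (R1 L o s).Avail (RD.rdT L) (4 * L + 1) K Γ
  /-- `RD2_s` -/
  hR2 : ∀ s < L, (R2 L o s).Avail (RD.rdT L) (4 * L + 1) K Γ

end Views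

variable {L} {o : Occ} {K : PropForm ℕ} {Γ : Set (PropForm ℕ)}

/-- The base of the occurrence of piece `k`. [folklore] -/
theorem base_q (hL : 0 < L) (k : ℕ) : (pieceOcc (o.inst (4 * L + 1)) (pieces L) k).base = o.base + offF L k := by
  simp [pieceOcc, offset_pieces L hL k]

/-- An input of a piece wired to a kit input. [folklore] -/
theorem inp_q_inl {k i j : ℕ} (hw : (pieces L k).wire i = Sum.inl j) (hj : j < 4 * L + 1) :
    (pieceOcc (o.inst (4 * L + 1)) (pieces L) k).inp i = o.inp j := by
  rw [inp_pieceOcc, hw, Occ.ref_inl o hj]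

/-- An input of a piece wired to an earlier gate. [folklore] -/
theorem inp_q_inr {k i g : ℕ} (hw : (pieces L k).wire i = Sum.inr g) :
    (pieceOcc (o.inst (4 * L + 1)) (pieces L) k).inp i = o.base + g := by
  rw [inp_pieceOcc, hw, Occ.ref_inr]; rfl

/-- A reference to `C` resolves to `Cw`. [folklore] -/
theorem ref_Cref (k j : ℕ) : (o.inst (4 * L + 1)).ref (Cref L k j) = Cw L o k j := by
  unfold Cref Cw; split_ifs <;> exact Occ.ref_inl o (by omega)

/-- `P`-gates of a view at offset `oV`. [folklore] -/
theorem pP_view (oV t i : ℕ) (a b n : ℕ → ℕ) : o.base + LD.pP L oV t i = (⟨o.base + oV, a, b, n⟩ : View).P L t i := by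
  unfold LD.pP View.P; split_ifs <;> simp [Nat.add_assoc]

/-- Availability of the comparators and `AB`. [folklore] -/
theorem avail_fixed (hL : 0 < L) (ho : o.Avail (assocT L) (4 * L + 1) K Γ) :
    (CmpA L o).Avail K Γ L ∧ (CmpB L o).Avail K Γ L ∧ (AB L o).RAvail L K Γ := by
  obtain ⟨p0, p1, p2⟩ := pieces_012 L
  have h0 : (pieceOcc (o.inst (4 * L + 1)) (pieces L) 0).Avail (Sub.subT L) (2 * L) K Γ := by
    have := Inst.DefsAvail.piece ho (k := 0) (by omega) (by rw [p0]; exact Sub.wf_subT L); rw [p0] at this; exact this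
  have h1 : (pieceOcc (o.inst (4 * L + 1)) (pieces L) 1).Avail (Sub.subT L) (2 * L) K Γ := by
    have := Inst.DefsAvail.piece ho (k := 1) (by omega) (by rw [p1]; exact Sub.wf_subT L); rw [p1] at this; exact this
  have h2 : (pieceOcc (o.inst (4 * L + 1)) (pieces L) 2).Avail (mulRT L) (3 * L) K Γ := by
    have := Inst.DefsAvail.piece ho (k := 2) (by omega) (by rw [p2]; exact wf_mulRT L); rw [p2] at this; exact this
  refine ⟨?_, ?_, ?_⟩
  · refine Sub.View.Avail.congr (Sub.avail_viewOf h0) ?_ (fun i hi => ?_) (fun i hi => ?_)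
    · show o.base = (pieceOcc (o.inst (4 * L + 1)) (pieces L) 0).base; rw [base_q hL]; rfl
    · show o.inp i = ((pieceOcc (o.inst (4 * L + 1)) (pieces L) 0).inst (2 * L)).inputs.getD i 0
      rw [Occ.getD_inst _ (show i < 2 * L by omega), inp_q_inl (k := 0) (i := i) (j := i) (by rw [p0]; dsimp only; rw [if_pos hi]) (by omega)]
    · show o.inp (3 * L + i) = ((pieceOcc (o.inst (4 * L + 1)) (pieces L) 0).inst (2 * L)).inputs.getD (L + i) 0
      have hw : (pieces L 0).wire (L + i) = Sum.inl (3 * L + i) := by rw [p0]; dsimp only; rw [if_neg (show ¬L + i < L by omega)]; congr 1; omega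
      rw [Occ.getD_inst _ (show L + i < 2 * L by omega), inp_q_inl hw (by omega)]
  · refine Sub.View.Avail.congr (Sub.avail_viewOf h1) ?_ (fun i hi => ?_) (fun i hi => ?_)
    · show o.base + (3 * L + 1) = (pieceOcc (o.inst (4 * L + 1)) (pieces L) 1).base; rw [base_q hL]; rfl
    · show o.inp (L + i) = ((pieceOcc (o.inst (4 * L + 1)) (pieces L) 1).inst (2 * L)).inputs.getD i 0
      rw [Occ.getD_inst _ (show i < 2 * L by omega), inp_q_inl (k := 1) (i := i) (j := L + i) (by rw [p1]; dsimp only; rw [if_pos hi]) (by omega)]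
    · show o.inp (3 * L + i) = ((pieceOcc (o.inst (4 * L + 1)) (pieces L) 1).inst (2 * L)).inputs.getD (L + i) 0
      have hw : (pieces L 1).wire (L + i) = Sum.inl (3 * L + i) := by rw [p1]; dsimp only; rw [if_neg (show ¬L + i < L by omega)]; congr 1; omega
      rw [Occ.getD_inst _ (show L + i < 2 * L by omega), inp_q_inl hw (by omega)]
  · refine (ravail_ofOcc h2).congr ?_ (fun i hi => ?_) (fun i hi => ?_) (fun i hi => ?_)
    · show o.base + oAB L = (pieceOcc (o.inst (4 * L + 1)) (pieces L) 2).base; rw [base_q hL, offF_mul L le_rfl (by omega)]; simp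
    · show o.inp i = (pieceOcc (o.inst (4 * L + 1)) (pieces L) 2).inp i
      rw [inp_q_inl (k := 2) (i := i) (j := i) (by rw [p2]; dsimp only; rw [if_pos (by omega)]) (by omega)]
    · show o.inp (L + i) = (pieceOcc (o.inst (4 * L + 1)) (pieces L) 2).inp (L + i)
      rw [inp_q_inl (k := 2) (i := L + i) (j := L + i) (by rw [p2]; dsimp only; rw [if_pos (by omega)]) (by omega)]
    · show o.inp (3 * L + i) = (pieceOcc (o.inst (4 * L + 1)) (pieces L) 2).inp (2 * L + i)
      have hw : (pieces L 2).wire (2 * L + i) = Sum.inl (3 * L + i) := by rw [p2]; dsimp only; rw [if_neg (show ¬2 * L + i < 2 * L by omega)]; congr 1; omega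
      rw [inp_q_inl hw (by omega)]

/-- Availability of `BC_s`. [folklore] -/
theorem avail_BC (hL : 0 < L) (ho : o.Avail (assocT L) (4 * L + 1) K Γ) {s : ℕ} (hs : s ≤ L) : (BC L o s).RAvail L K Γ := by
  have hq : (pieceOcc (o.inst (4 * L + 1)) (pieces L) (3 + s)).Avail (mulRT L) (3 * L) K Γ := by
    have := Inst.DefsAvail.piece ho (k := 3 + s) (by omega) (by rw [pieces_BC L hs]; exact wf_mulRT L); rw [pieces_BC L hs] at this; exact this
  refine (ravail_ofOcc hq).congr ?_ (fun i hi => ?_) (fun i hi => ?_) (fun i hi => ?_)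
  · show o.base + oBC L s = (pieceOcc (o.inst (4 * L + 1)) (pieces L) (3 + s)).base
    rw [base_q hL, offF_mul L (by omega) (by omega), show 3 + s - 2 = 1 + s by omega]; rfl
  · show o.inp (L + i) = (pieceOcc (o.inst (4 * L + 1)) (pieces L) (3 + s)).inp i
    rw [inp_q_inl (k := 3 + s) (i := i) (j := L + i) (by rw [pieces_BC L hs]; dsimp only; unfold wBC; rw [if_pos hi]) (by omega)]
  · show Cw L o (L - s) i = (pieceOcc (o.inst (4 * L + 1)) (pieces L) (3 + s)).inp (L + i)
    rw [inp_pieceOcc, pieces_BC L hs]; dsimp only; unfold wBC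
    rw [if_neg (show ¬L + i < L by omega), if_pos (show L + i < 2 * L by omega), Nat.add_sub_cancel_left, ref_Cref]
  · show o.inp (3 * L + i) = (pieceOcc (o.inst (4 * L + 1)) (pieces L) (3 + s)).inp (2 * L + i)
    have hw : (pieces L (3 + s)).wire (2 * L + i) = Sum.inl (3 * L + i) := by
      rw [pieces_BC L hs]; dsimp only; unfold wBC
      rw [if_neg (show ¬2 * L + i < L by omega), if_neg (show ¬2 * L + i < 2 * L by omega)]; congr 1; omega
    rw [inp_q_inl hw (by omega)]

/-- Availability of `LHS_s`. [folklore] -/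
theorem avail_LHS (hL : 0 < L) (ho : o.Avail (assocT L) (4 * L + 1) K Γ) {s : ℕ} (hs : s ≤ L) : (LHS L o s).RAvail L K Γ := by
  have hq : (pieceOcc (o.inst (4 * L + 1)) (pieces L) (4 + L + s)).Avail (mulRT L) (3 * L) K Γ := by
    have := Inst.DefsAvail.piece ho (k := 4 + L + s) (by omega) (by rw [pieces_LHS L hs]; exact wf_mulRT L); rw [pieces_LHS L hs] at this; exact this
  refine (ravail_ofOcc hq).congr ?_ (fun i hi => ?_) (fun i hi => ?_) (fun i hi => ?_)
  · show o.base + oLHS L s = (pieceOcc (o.inst (4 * L + 1)) (pieces L) (4 + L + s)).base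
    rw [base_q hL, offF_mul L (by omega) (by omega), show 4 + L + s - 2 = 2 + L + s by omega]; rfl
  · show (AB L o).P L L i = (pieceOcc (o.inst (4 * L + 1)) (pieces L) (4 + L + s)).inp i
    have hw : (pieces L (4 + L + s)).wire i = Sum.inr (LD.pP L (oAB L) L i) := by rw [pieces_LHS L hs]; dsimp only; unfold wLHS; rw [if_pos hi]
    rw [inp_q_inr hw, pP_view (o := o) _ _ _ (av o) (bv L o) (nv L o)]; rfl
  · show Cw L o (L - s) i = (pieceOcc (o.inst (4 * L + 1)) (pieces L) (4 + L + s)).inp (L + i)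
    rw [inp_pieceOcc, pieces_LHS L hs]; dsimp only; unfold wLHS
    rw [if_neg (show ¬L + i < L by omega), if_pos (show L + i < 2 * L by omega), Nat.add_sub_cancel_left, ref_Cref]
  · show o.inp (3 * L + i) = (pieceOcc (o.inst (4 * L + 1)) (pieces L) (4 + L + s)).inp (2 * L + i)
    have hw : (pieces L (4 + L + s)).wire (2 * L + i) = Sum.inl (3 * L + i) := by
      rw [pieces_LHS L hs]; dsimp only; unfold wLHS
      rw [if_neg (show ¬2 * L + i < L by omega), if_neg (show ¬2 * L + i < 2 * L by omega)]; congr 1; omega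
    rw [inp_q_inl hw (by omega)]

/-- Availability of `ABC_s`. [folklore] -/
theorem avail_ABC (hL : 0 < L) (ho : o.Avail (assocT L) (4 * L + 1) K Γ) {s : ℕ} (hs : s ≤ L) : (ABC L o s).RAvail L K Γ := by
  have hq : (pieceOcc (o.inst (4 * L + 1)) (pieces L) (5 + 2 * L + s)).Avail (mulRT L) (3 * L) K Γ := by
    have := Inst.DefsAvail.piece ho (k := 5 + 2 * L + s) (by omega) (by rw [pieces_ABC L hs]; exact wf_mulRT L)
    rw [pieces_ABC L hs] at this; exact this
  refine (ravail_ofOcc hq).congr ?_ (fun i hi => ?_) (fun i hi => ?_) (fun i hi => ?_)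
  · show o.base + oABC L s = (pieceOcc (o.inst (4 * L + 1)) (pieces L) (5 + 2 * L + s)).base
    rw [base_q hL, offF_mul L (by omega) (by omega), show 5 + 2 * L + s - 2 = 3 + 2 * L + s by omega]; rfl
  · show o.inp i = (pieceOcc (o.inst (4 * L + 1)) (pieces L) (5 + 2 * L + s)).inp i
    rw [inp_q_inl (k := 5 + 2 * L + s) (i := i) (j := i) (by rw [pieces_ABC L hs]; dsimp only; unfold wABC; rw [if_pos hi]) (by omega)]
  · show (BC L o s).P L L i = (pieceOcc (o.inst (4 * L + 1)) (pieces L) (5 + 2 * L + s)).inp (L + i)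
    have hw : (pieces L (5 + 2 * L + s)).wire (L + i) = Sum.inr (LD.pP L (oBC L s) L i) := by
      rw [pieces_ABC L hs]; dsimp only; unfold wABC
      rw [if_neg (show ¬L + i < L by omega), if_pos (show L + i < 2 * L by omega), Nat.add_sub_cancel_left]
    rw [inp_q_inr hw, pP_view (o := o) _ _ _ (bv L o) (Cw L o (L - s)) (nv L o)]; rfl
  · show o.inp (3 * L + i) = (pieceOcc (o.inst (4 * L + 1)) (pieces L) (5 + 2 * L + s)).inp (2 * L + i)
    have hw : (pieces L (5 + 2 * L + s)).wire (2 * L + i) = Sum.inl (3 * L + i) := by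
      rw [pieces_ABC L hs]; dsimp only; unfold wABC
      rw [if_neg (show ¬2 * L + i < L by omega), if_neg (show ¬2 * L + i < 2 * L by omega)]; congr 1; omega
    rw [inp_q_inl hw (by omega)]

/-- Availability of the right-distributivity kits. [folklore] -/
theorem avail_R (ho : o.Avail (assocT L) (4 * L + 1) K Γ) (hL : 0 < L) {s : ℕ} (hs : s < L) :
    (R1 L o s).Avail (RD.rdT L) (4 * L + 1) K Γ ∧ (R2 L o s).Avail (RD.rdT L) (4 * L + 1) K Γ := by
  constructor
  · have := Inst.DefsAvail.piece ho (k := 6 + 3 * L + 2 * s) (by omega) (by rw [pieces_R1]; exact RD.wf_rdT L hL)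
    rw [pieces_R1] at this; exact this
  · have := Inst.DefsAvail.piece ho (k := 7 + 3 * L + 2 * s) (by omega) (by rw [pieces_R2]; exact RD.wf_rdT L hL)
    rw [pieces_R2] at this; exact this

/-- **All pieces of an available occurrence of the associativity kit are available.** [folklore] -/
theorem avail_ofOcc (hL : 0 < L) (ho : o.Avail (assocT L) (4 * L + 1) K Γ) : AAvail L o K Γ :=
  ⟨(avail_fixed hL ho).1, (avail_fixed hL ho).2.1, (avail_fixed hL ho).2.2, fun _ hs => avail_BC hL ho hs, fun _ hs => avail_LHS hL ho hs,
    fun _ hs => avail_ABC hL ho hs, fun _ hs => (avail_R ho hL hs).1, fun _ hs => (avail_R ho hL hs).2⟩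

/-! ### The inputs of the right-distributivity kits -/

/-- The inputs of `RD1_s`: `(a, R(D_{L-1}(BC_{s+1})), mk_{L-1}(BC_{s+1}), n, z)`. [folklore] -/
theorem R1_inp (hL : 0 < L) {s i : ℕ} (hi : i < L) :
    (R1 L o s).inp i = o.inp i ∧ (R1 L o s).inp (L + i) = ((BC L o (s + 1)).Dv L (L - 1)).R L i ∧
      (R1 L o s).inp (2 * L + i) = (BC L o (s + 1)).msk L (L - 1) i ∧ (R1 L o s).inp (3 * L + i) = o.inp (3 * L + i) ∧
      (R1 L o s).inp (4 * L) = o.inp (4 * L) := by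
  have e : R1 L o s = pieceOcc (o.inst (4 * L + 1)) (pieces L) (6 + 3 * L + 2 * s) := rfl
  refine ⟨?_, ?_, ?_, ?_, ?_⟩
  · rw [e, inp_q_inl (k := 6 + 3 * L + 2 * s) (i := i) (j := i) (by rw [pieces_R1]; dsimp only; unfold wR1; rw [if_pos hi]) (by omega)]
  · have hw : (pieces L (6 + 3 * L + 2 * s)).wire (L + i) = Sum.inr (oBC L (s + 1) + offD L (L - 1) + (5 * L + 2) + i) := by
      rw [pieces_R1]; dsimp only; unfold wR1
      rw [if_neg (show ¬L + i < L by omega), if_pos (show L + i < 2 * L by omega), Nat.add_sub_cancel_left]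
    rw [e, inp_q_inr hw]; simp [BC, View.Dv, ModAddU.View.R, Nat.add_assoc]
  · have hw : (pieces L (6 + 3 * L + 2 * s)).wire (2 * L + i) = Sum.inr (oBC L (s + 1) + offM L (L - 1) + i) := by
      rw [pieces_R1]; dsimp only; unfold wR1
      rw [if_neg (show ¬2 * L + i < L by omega), if_neg (show ¬2 * L + i < 2 * L by omega), if_pos (show 2 * L + i < 3 * L by omega),
        show 2 * L + i - 2 * L = i by omega]
    rw [e, inp_q_inr hw]; simp [BC, View.msk, Nat.add_assoc]
  · have hw : (pieces L (6 + 3 * L + 2 * s)).wire (3 * L + i) = Sum.inl (3 * L + i) := by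
      rw [pieces_R1]; dsimp only; unfold wR1
      rw [if_neg (show ¬3 * L + i < L by omega), if_neg (show ¬3 * L + i < 2 * L by omega), if_neg (show ¬3 * L + i < 3 * L by omega),
        if_pos (show 3 * L + i < 4 * L by omega)]
    rw [e, inp_q_inl hw (by omega)]
  · have hw : (pieces L (6 + 3 * L + 2 * s)).wire (4 * L) = Sum.inl (4 * L) := by
      rw [pieces_R1]; dsimp only; unfold wR1
      rw [if_neg (by omega), if_neg (by omega), if_neg (by omega), if_neg (by omega)]
    rw [e, inp_q_inl hw (by omega)]

/-- The inputs of `RD2_s`: `(a, P_{L-1}(BC_{s+1}), P_{L-1}(BC_{s+1}), n, z)`. [folklore] -/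
theorem R2_inp (hL : 0 < L) {s i : ℕ} (hi : i < L) :
    (R2 L o s).inp i = o.inp i ∧ (R2 L o s).inp (L + i) = (BC L o (s + 1)).P L (L - 1) i ∧
      (R2 L o s).inp (2 * L + i) = (BC L o (s + 1)).P L (L - 1) i ∧ (R2 L o s).inp (3 * L + i) = o.inp (3 * L + i) ∧
      (R2 L o s).inp (4 * L) = o.inp (4 * L) := by
  have e : R2 L o s = pieceOcc (o.inst (4 * L + 1)) (pieces L) (7 + 3 * L + 2 * s) := rfl
  refine ⟨?_, ?_, ?_, ?_, ?_⟩
  · rw [e, inp_q_inl (k := 7 + 3 * L + 2 * s) (i := i) (j := i) (by rw [pieces_R2]; dsimp only; unfold wR2; rw [if_pos hi]) (by omega)]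
  · have hw : (pieces L (7 + 3 * L + 2 * s)).wire (L + i) = Sum.inr (LD.pP L (oBC L (s + 1)) (L - 1) i) := by
      rw [pieces_R2]; dsimp only; unfold wR2
      rw [if_neg (show ¬L + i < L by omega), if_pos (show L + i < 2 * L by omega), Nat.add_sub_cancel_left]
    rw [e, inp_q_inr hw, pP_view (o := o) _ _ _ (bv L o) (Cw L o (L - (s + 1))) (nv L o)]; rfl
  · have hw : (pieces L (7 + 3 * L + 2 * s)).wire (2 * L + i) = Sum.inr (LD.pP L (oBC L (s + 1)) (L - 1) i) := by
      rw [pieces_R2]; dsimp only; unfold wR2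
      rw [if_neg (show ¬2 * L + i < L by omega), if_neg (show ¬2 * L + i < 2 * L by omega), if_pos (show 2 * L + i < 3 * L by omega),
        show 2 * L + i - 2 * L = i by omega]
    rw [e, inp_q_inr hw, pP_view (o := o) _ _ _ (bv L o) (Cw L o (L - (s + 1))) (nv L o)]; rfl
  · have hw : (pieces L (7 + 3 * L + 2 * s)).wire (3 * L + i) = Sum.inl (3 * L + i) := by
      rw [pieces_R2]; dsimp only; unfold wR2
      rw [if_neg (show ¬3 * L + i < L by omega), if_neg (show ¬3 * L + i < 2 * L by omega), if_neg (show ¬3 * L + i < 3 * L by omega),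
        if_pos (show 3 * L + i < 4 * L by omega)]
    rw [e, inp_q_inl hw (by omega)]
  · have hw : (pieces L (7 + 3 * L + 2 * s)).wire (4 * L) = Sum.inl (4 * L) := by
      rw [pieces_R2]; dsimp only; unfold wR2
      rw [if_neg (by omega), if_neg (by omega), if_neg (by omega), if_neg (by omega)]
    rw [e, inp_q_inl hw (by omega)]

end Assoc

end ModMulU

end Literature.Computability.MetaComplexity
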